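import Literature.MathematicalPhysics.QuantumFieldTheory.OSRegularisedDensityWindow
import Literature.MathematicalPhysics.QuantumFieldTheory.OSSkeletonGeometricBounds
import HarnessLib

/-!
# The smeared skeleton and its sector extension through geometric profile bounds (OS II, Ch. VI.1)

Topic `Literature/MathematicalPhysics/QuantumFieldTheory`; support file (all proved; the geometric
profile constant as a definition; no named facts), the geometric companion of
`OSRegularisedDensity(Window)` for the temperedness estimate (4.5) of Osterwalder–Schrader II
(Comm. Math. Phys. 42 (1975), Thm. 4.1) **with exponent linear in the number of points** (Ch. VI.1
(6.8)–(6.13)). The logarithmic-slot engine (`LogSlot.l1TubeExtension_logT_spec`) is re-run with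
the slot constants of `OSSkeletonGeometricBounds.norm_slotExtV_le_geometric`: these have the same
shape `P · unitSlotC j` as in `OSRegularisedDensity`, with the per-factor product `∏ⱼ |φⱼ|_M`
replaced by the **geometric profile constant**
`P = geomProf = 2^{k+2} a^{k+2} R^{2M} max(1,(k+2)B)^{2M} / (2^{M+1})^{k+2}`, so that all the
downstream constants (`unitSlotBmaxW`, `unitTubeConstW`, the sector extension and its bound
`norm_logSectorExt_le`) are reused verbatim:

* `geomProf`, `norm_slotEr_le_geometric` (hypothesis `hCN` of the engine);
* `l1TubeExtension_logT_skelSVr_spec_geometric` — holomorphy on `{∑|Im ζⱼ| < π/2}`, the bound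
  `‖F ζ‖ ≤ geomProf · unitSlotBmaxW · unitTubeConstW c` on `{∑ |Im ζⱼ| ≤ c}`, the real-point identity;
* `geomG`, `norm_geomG_le`, `differentiableOn_geomG`, `geomG_eRealPt` — the sector extension
  `z ↦ logSectorExt b F (tailC z)` near a real point: bound, holomorphy, and real values
  `= skelSVr φ (tailR x)` (the smeared Schwinger function).

## References

* K. Osterwalder, R. Schrader, *Axioms for Euclidean Green's functions II*, Comm. Math. Phys. 42
  (1975) 281–305, Ch. V (5.7)–(5.8), Ch. VI.1 (6.8)–(6.13). [OsterwalderSchraderCMP1975]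
-/

noncomputable section

open MeasureTheory Complex Set Metric Filter
open _root_.Topology
open scoped InnerProductSpace RealInnerProductSpace SchwartzMap NNReal Real

namespace Literature.MathematicalPhysics.QuantumFieldTheory

open Literature.MathematicalPhysics.QuantumLattice (SchwingerFamily IsPositiveTimeMulti schwartzNorm)
open Literature.MathematicalPhysics.QuantumLattice.SchwingerFamily
open Literature.MathematicalPhysics.QuantumLattice.SchwingerFamily.OSSpace
open Literature.Analysis.FunctionSpaces.SchwartzAverage
open Literature.Analysis.Distribution
open Literature.Analysis.Complex
open OSFrames

variable {d : ℕ}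

/-! ### The geometric profile constant and the slot bound -/

section SlotData

variable [NeZero d] (𝔖 : SchwingerFamily (EuclideanSpace ℝ (Fin d)))
  (hE2 : 𝔖.IsOSReflectionPositive) {k : ℕ}
  (ξ : Fin (k + 1) → EuclideanSpace ℝ (Fin d)) (ê : Fin d → EuclideanSpace ℝ (Fin d)) {g r₀ : ℝ}

omit [NeZero d] in
/-- **The geometric profile constant** `2^{k+2} a^{k+2} R^{2M} max(1,(k+2)B)^{2M} / (2^{M+1})^{k+2}`
(replacing `∏ⱼ |φⱼ|_M`). [cite: OsterwalderSchraderCMP1975, Ch. VI.1 (6.12), (6.17)] -/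
def geomProf (k M : ℕ) (a R B : ℝ) : ℝ :=
  2 ^ (k + 2) * a ^ (k + 2) * R ^ (M + M) * max 1 (((k : ℝ) + 2) * B) ^ (M + M) / (2 ^ (M + 1)) ^ (k + 2)

omit [NeZero d] in
/-- `geomProf ≥ 0`. [folklore] -/
theorem geomProf_nonneg (k M : ℕ) {a R B : ℝ} (ha : 0 ≤ a) (hR : 1 ≤ R) : 0 ≤ geomProf k M a R B := by
  unfold geomProf; positivity

omit [NeZero d] in
/-- `geomProf · (2^{M+1})^{k+2} = 2^{k+2} a^{k+2} R^{2M} max(1,(k+2)B)^{2M}`. [folklore] -/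
theorem geomProf_mul (k M : ℕ) (a R B : ℝ) :
    geomProf k M a R B * (2 ^ (M + 1)) ^ (k + 2) = 2 ^ (k + 2) * a ^ (k + 2) * R ^ (M + M) * max 1 (((k : ℝ) + 2) * B) ^ (M + M) := by
  unfold geomProf
  rw [div_mul_cancel₀ _ (by positivity)]

/-- **The slot functions through geometric profile bounds** (hypothesis `hCN` of the engine), in the
shape `geomProf · unitSlotC j · (1 + ‖v'‖)^{2M}`. [cite: OsterwalderSchraderCMP1975, Ch. VI.1 p. 297] -/
theorem norm_slotEr_le_geometric (hE1 : 𝔖.IsEuclideanCovariant)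
    (hê1 : ∀ μ, ‖ê μ‖ = 1) (hêê : ∀ μ ν, 0 ≤ ⟪ê μ, ê ν⟫) (hξ : ∀ μ i', g ≤ ⟪ê μ, ξ i'⟫)
    (hg : 2 * r₀ < g) (hr₀ : 0 ≤ r₀) (φ : Fin (k + 2) → 𝓢(EuclideanSpace ℝ (Fin d), ℂ))
    (hφ : ∀ j, tsupport (φ j : EuclideanSpace ℝ (Fin d) → ℂ) ⊆ Metric.closedBall 0 r₀)
    {s : ℕ} {Cv : ℕ → ℝ} (hCv : ∀ n, 0 ≤ Cv n)
    (hv : ∀ (n : ℕ) (K : 𝓢((Fin n → EuclideanSpace ℝ (Fin d)), ℂ)) (hK : IsPositiveTimeMulti K),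
      ‖ι 𝔖 hE2 (δ 𝔖 hE2 (mkGen K hK))‖ ≤ Cv n * schwartzNorm ((n + n) * s) K)
    {M : ℕ} (hM : (k + 1 + (k + 1)) * s ≤ M)
    {a R B : ℝ} (hR : 1 ≤ R) (hB : 0 ≤ B) (ha : 0 ≤ a)
    (hφg : ∀ j, ∀ k' ≤ M, ∀ i' ≤ M, SchwartzMap.seminorm ℝ k' i' (φ j) ≤ a * R ^ k' * B ^ i')
    (j : Fin (slotK k d + 1)) (v' : Fin (slotK k d) → ℝ) {τ : ℂ} (hτ : 0 ≤ τ.re) :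
    ‖slotEr 𝔖 hE1 hE2 φ ξ ê hφ hê1 hêê hξ hg hr₀ j v' τ‖ ≤
      geomProf k M a R B * unitSlotC ξ ê g Cv M j * (1 + ‖v'‖) ^ (M + M) := by
  unfold slotEr
  have hi := (slotEquiv k d j).1.isLt
  have hML : (nL (slotEquiv k d j).1 + nL (slotEquiv k d j).1) * s ≤ M := by
    refine le_trans (Nat.mul_le_mul_right _ ?_) hM
    simp only [nL]; omega
  have hMR : (nR (slotEquiv k d j).1 + nR (slotEquiv k d j).1) * s ≤ M := by
    refine le_trans (Nat.mul_le_mul_right _ ?_) hM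
    simp only [nR]; omega
  have h := norm_slotExtV_le_geometric 𝔖 hE1 hE2 φ ξ ê (slotEquiv k d j).1 (slotEquiv k d j).2 hφ
    (hê1 _) (hêê _) (hξ _) hg hr₀ hCv hv hML hMR hR hB ha hφg (reindexV (j.insertNth (0 : ℝ) v')) hτ
  rw [norm_reindexV, norm_insertNth_zero] at h
  refine h.trans (le_of_eq ?_)
  unfold unitSlotC
  rw [← geomProf_mul k M a R B]
  ring

/-- **The logarithmic-slot engine for the profile-smeared skeleton, geometric form**: for
`F = l1TubeExtension b (logT 𝒮ᵣ b)`, holomorphy on `{∑ |Im zⱼ| < π/2}`, the bound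
`‖F z‖ ≤ geomProf · unitSlotBmaxW · unitTubeConstW c` on `{∑ |Im zⱼ| ≤ c}`, and the real-point identity. [cite: OsterwalderSchraderCMP1975, Ch. V (5.7)–(5.8), Ch. VI.1 (6.12)–(6.13)] -/
theorem l1TubeExtension_logT_skelSVr_spec_geometric (hE1 : 𝔖.IsEuclideanCovariant)
    (hê1 : ∀ μ, ‖ê μ‖ = 1) (hêê : ∀ μ ν, 0 ≤ ⟪ê μ, ê ν⟫) (hξ : ∀ μ i', g ≤ ⟪ê μ, ξ i'⟫)
    (hg : 2 * r₀ < g) (hr₀ : 0 ≤ r₀) {b : ℝ} (hb : 0 < b)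
    (φ : Fin (k + 2) → 𝓢(EuclideanSpace ℝ (Fin d), ℂ))
    (hφ : ∀ j, tsupport (φ j : EuclideanSpace ℝ (Fin d) → ℂ) ⊆ Metric.closedBall 0 r₀)
    {s : ℕ} {Cv : ℕ → ℝ} (hCv : ∀ n, 0 ≤ Cv n)
    (hv : ∀ (n : ℕ) (K : 𝓢((Fin n → EuclideanSpace ℝ (Fin d)), ℂ)) (hK : IsPositiveTimeMulti K),
      ‖ι 𝔖 hE2 (δ 𝔖 hE2 (mkGen K hK))‖ ≤ Cv n * schwartzNorm ((n + n) * s) K)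
    {M : ℕ} (hM : (k + 1 + (k + 1)) * s ≤ M)
    {s₀ : ℕ} {C₀ : ℝ} (hC₀ : 0 ≤ C₀)
    (hσ : ∀ F : 𝓢((Fin (k + 2) → EuclideanSpace ℝ (Fin d)), ℂ), ‖𝔖 (k + 2) F‖ ≤ C₀ * schwartzNorm s₀ F)
    {a R B : ℝ} (hR : 1 ≤ R) (hB : 0 ≤ B) (ha : 0 ≤ a)
    (hφg : ∀ j, ∀ k' ≤ M, ∀ i' ≤ M, SchwartzMap.seminorm ℝ k' i' (φ j) ≤ a * R ^ k' * B ^ i') :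
    DifferentiableOn ℂ (l1TubeExtension b (LogSlot.logT (skelSVr 𝔖 φ ξ ê) b))
        {z : Fin (slotK k d + 1) → ℂ | ∑ j, |(z j).im| < π / 2} ∧
      (∀ c : ℝ, c < π / 2 → ∀ z : Fin (slotK k d + 1) → ℂ, ∑ j, |(z j).im| ≤ c →
        ‖l1TubeExtension b (LogSlot.logT (skelSVr 𝔖 φ ξ ê) b) z‖ ≤
          geomProf k M a R B * unitSlotBmaxW ξ ê g b Cv M * unitTubeConstW b (slotK k d) c) ∧
      ∀ x : Fin (slotK k d + 1) → ℝ, l1TubeExtension b (LogSlot.logT (skelSVr 𝔖 φ ξ ê) b) (fun j => (x j : ℂ)) =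
        LogSlot.logDensity (skelSVr 𝔖 φ ξ ê) b x := by
  have hSc : Continuous (skelSVr 𝔖 φ ξ ê) := (continuous_skelSV 𝔖 φ ξ ê).comp continuous_reindexV
  have hP0 : 0 ≤ geomProf k M a R B := geomProf_nonneg k M ha hR
  obtain ⟨hF, hK, -, -, hreal⟩ := LogSlot.l1TubeExtension_logT_spec (skelSVr 𝔖 φ ξ ê)
    (slotEr 𝔖 hE1 hE2 φ ξ ê hφ hê1 hêê hξ hg hr₀) hb hSc (norm_skelSVr_le 𝔖 ξ ê φ hC₀ hσ)
    (continuous_slotEr_left 𝔖 hE1 hE2 ξ ê hê1 hêê hξ hg hr₀ φ hφ)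
    (differentiableOn_slotEr 𝔖 hE1 hE2 ξ ê hê1 hêê hξ hg hr₀ φ hφ)
    (fun j => geomProf k M a R B * unitSlotC ξ ê g Cv M j) (fun _ => M + M)
    (fun j => mul_nonneg hP0 (unitSlotC_nonneg ξ ê hCv M j))
    (fun j v' _ hτ => norm_slotEr_le_geometric 𝔖 hE2 ξ ê hE1 hê1 hêê hξ hg hr₀ φ hφ hCv hv hM hR hB ha hφg j v' hτ)
    (slotEr_ofReal 𝔖 hE1 hE2 ξ ê hê1 hêê hξ hg hr₀ φ hφ)
  refine ⟨hF, fun c hc z hz => (hK c hc z hz).trans ?_, hreal⟩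
  rw [l1TubeBound_const_mul]
  have hL := l1TubeBound_one_nonneg (π / 2) b 0 (slotK k d + 1) (fun _ => 0) c
  have hBm := LogSlot.slotBmax_const_mul_le hP0 b (unitSlotC ξ ê g Cv M) (fun _ => M + M)
  unfold unitSlotBmaxW unitTubeConstW
  calc LogSlot.slotBmax b (fun j => geomProf k M a R B * unitSlotC ξ ê g Cv M j) (fun _ => M + M) *
        l1TubeBound (π / 2) b 0 (slotK k d + 1) (fun _ => 1) (fun _ => 0) c
      ≤ (geomProf k M a R B * LogSlot.slotBmax b (unitSlotC ξ ê g Cv M) fun _ => M + M) *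
        l1TubeBound (π / 2) b 0 (slotK k d + 1) (fun _ => 1) (fun _ => 0) c :=
        mul_le_mul_of_nonneg_right hBm hL
    _ = _ := by ring

end SlotData

/-! ### The sector extension near a real point -/

section Sector

variable [NeZero d] (𝔖 : SchwingerFamily (EuclideanSpace ℝ (Fin d)))
  (hE2 : 𝔖.IsOSReflectionPositive) {k : ℕ}
  (ξ : Fin (k + 1) → EuclideanSpace ℝ (Fin d)) (ê : Fin d → EuclideanSpace ℝ (Fin d)) {g r₀ : ℝ}

/-- **The sector extension of the smeared skeleton in all variables**:
`geomG b φ z = logSectorExt b (l1TubeExtension b (logT 𝒮ᵣ[φ] b)) (tail z)`. [cite: OsterwalderSchraderCMP1975, Ch. VI.1 (6.8)–(6.9)] -/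
def geomG (b : ℝ) (φ : Fin (k + 2) → 𝓢(EuclideanSpace ℝ (Fin d), ℂ)) (z : Fin (k + 2) × Fin d → ℂ) : ℂ :=
  logSectorExt b (l1TubeExtension b (LogSlot.logT (skelSVr 𝔖 φ ξ ê) b)) (tailC z)

variable {b : ℝ} (hb : 0 < b) (hE1 : 𝔖.IsEuclideanCovariant)
  (hê1 : ∀ μ, ‖ê μ‖ = 1) (hêê : ∀ μ ν, 0 ≤ ⟪ê μ, ê ν⟫) (hξ : ∀ μ i', g ≤ ⟪ê μ, ξ i'⟫)
  (hg : 2 * r₀ < g) (hr₀ : 0 ≤ r₀)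
  {s : ℕ} {Cv : ℕ → ℝ} (hCv : ∀ n, 0 ≤ Cv n)
  (hv : ∀ (n : ℕ) (K : 𝓢((Fin n → EuclideanSpace ℝ (Fin d)), ℂ)) (hK : IsPositiveTimeMulti K),
    ‖ι 𝔖 hE2 (δ 𝔖 hE2 (mkGen K hK))‖ ≤ Cv n * schwartzNorm ((n + n) * s) K)
  {M : ℕ} (hM : (k + 1 + (k + 1)) * s ≤ M)
  {s₀ : ℕ} {C₀ : ℝ} (hC₀ : 0 ≤ C₀)
  (hσ : ∀ F : 𝓢((Fin (k + 2) → EuclideanSpace ℝ (Fin d)), ℂ), ‖𝔖 (k + 2) F‖ ≤ C₀ * schwartzNorm s₀ F)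
  {a R B : ℝ} (hR : 1 ≤ R) (hB : 0 ≤ B) (ha : 0 ≤ a)

include hb hE1 hê1 hêê hξ hg hr₀ hCv hv hM hC₀ hσ hR hB ha

/-- **The bound of the sector extension** on the ball of radius `r` about a real point whose tail
coordinates dominate `r`:
`‖geomG b φ z‖ ≤ e^{2b(K+1)(logRadius + π/4)²} · geomProf · unitSlotBmaxW · unitTubeConstW(π/4)`. [cite: OsterwalderSchraderCMP1975, Ch. VI.1 (6.13)] -/
theorem norm_geomG_le (φ : Fin (k + 2) → 𝓢(EuclideanSpace ℝ (Fin d), ℂ))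
    (hφ : ∀ j, tsupport (φ j : EuclideanSpace ℝ (Fin d) → ℂ) ⊆ Metric.closedBall 0 r₀)
    (hφg : ∀ j, ∀ k' ≤ M, ∀ i' ≤ M, SchwartzMap.seminorm ℝ k' i' (φ j) ≤ a * R ^ k' * B ^ i')
    (x₀ : EuclideanSpace ℝ (Fin (k + 2) × Fin d)) {r : ℝ} (hr : 0 < r)
    (hrx : ∀ j, r ≤ tailR x₀ j * Real.sin (π / (4 * (slotK k d + 1))))
    {z : Fin (k + 2) × Fin d → ℂ} (hz : z ∈ ball (eRealPt x₀) r) :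
    ‖geomG 𝔖 ξ ê b φ z‖ ≤ Real.exp (2 * |b| * (slotK k d + 1) * (logRadius (tailR x₀) r + π / 4) ^ 2) *
      (geomProf k M a R B * unitSlotBmaxW ξ ê g b Cv M * unitTubeConstW b (slotK k d) (π / 4)) := by
  obtain ⟨-, hK, -⟩ := l1TubeExtension_logT_skelSVr_spec_geometric 𝔖 hE2 ξ ê hE1 hê1 hêê hξ hg hr₀ hb φ hφ hCv hv hM hC₀ hσ
    hR hB ha hφg
  have hρm : r < Finset.univ.inf' Finset.univ_nonempty (tailR x₀) :=
    (Finset.lt_inf'_iff _).2 fun j _ => (tailR_centre_pos hr hrx j).2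
  have hw' : tailC z ∈ ball (fun j => ((tailR x₀ j : ℝ) : ℂ)) r := by
    rw [← tailC_eRealPt]; exact tailC_mem_ball hz
  exact norm_logSectorExt_le b (hK (π / 4) (by linarith [Real.pi_pos])) hrx hρm hw'

/-- **Holomorphy of the sector extension** on the ball. [folklore] -/
theorem differentiableOn_geomG (φ : Fin (k + 2) → 𝓢(EuclideanSpace ℝ (Fin d), ℂ))
    (hφ : ∀ j, tsupport (φ j : EuclideanSpace ℝ (Fin d) → ℂ) ⊆ Metric.closedBall 0 r₀)
    (hφg : ∀ j, ∀ k' ≤ M, ∀ i' ≤ M, SchwartzMap.seminorm ℝ k' i' (φ j) ≤ a * R ^ k' * B ^ i')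
    (x₀ : EuclideanSpace ℝ (Fin (k + 2) × Fin d)) {r : ℝ}
    (hrx : ∀ j, r ≤ tailR x₀ j * Real.sin (π / (4 * (slotK k d + 1)))) :
    DifferentiableOn ℂ (geomG 𝔖 ξ ê b φ) (ball (eRealPt x₀) r) := by
  obtain ⟨hF, -, -⟩ := l1TubeExtension_logT_skelSVr_spec_geometric 𝔖 hE2 ξ ê hE1 hê1 hêê hξ hg hr₀ hb φ hφ hCv hv hM hC₀ hσ
    hR hB ha hφg
  have hsec : MapsTo tailC (ball (eRealPt x₀) r) (sectorRegion (slotK k d) (π / 2)) := fun z hz => by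
    have h1 := tailC_mem_ball hz
    rw [tailC_eRealPt] at h1
    have h2 := ball_subset_sectorRegion (K := slotK k d) (u := tailR x₀) hrx h1
    exact ⟨h2.1, h2.2.trans_le (by linarith [Real.pi_pos])⟩
  unfold geomG
  exact (differentiableOn_logSectorExt b hF).comp differentiable_tailC.differentiableOn hsec

/-- **Real values of the sector extension**: at a real point with positive tail coordinates,
`geomG b φ (eRealPt x) = 𝒮ᵣ[φ](tailR x)` — the smeared Schwinger function. [cite: OsterwalderSchraderCMP1975, Ch. VI.1 (6.8)] -/
theorem geomG_eRealPt (φ : Fin (k + 2) → 𝓢(EuclideanSpace ℝ (Fin d), ℂ))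
    (hφ : ∀ j, tsupport (φ j : EuclideanSpace ℝ (Fin d) → ℂ) ⊆ Metric.closedBall 0 r₀)
    (hφg : ∀ j, ∀ k' ≤ M, ∀ i' ≤ M, SchwartzMap.seminorm ℝ k' i' (φ j) ≤ a * R ^ k' * B ^ i')
    (x : EuclideanSpace ℝ (Fin (k + 2) × Fin d)) (hx : ∀ j, 0 < tailR x j) :
    geomG 𝔖 ξ ê b φ (eRealPt x) = skelSVr 𝔖 φ ξ ê (tailR x) := by
  obtain ⟨-, -, hreal⟩ := l1TubeExtension_logT_skelSVr_spec_geometric 𝔖 hE2 ξ ê hE1 hê1 hêê hξ hg hr₀ hb φ hφ hCv hv hM hC₀ hσ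
    hR hB ha hφg
  unfold geomG
  rw [tailC_eRealPt]
  exact logSectorExt_ofReal b (fun y => by rw [hreal y]; rfl) hx

end Sector

end Literature.MathematicalPhysics.QuantumFieldTheory
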